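import Summits.BirchSwinnertonDyer.BirchSwinnertonDyer.Theorems.KolyvaginRoadThreeSchneiderTamAtThreeHeightLogNumeratorExactLimit
import Literature.NumberTheory.EllipticCurves.SteinWuthrich2013.NonsplitMultCanonicalHolds
import HarnessLib

/-!
# Crux `SchneiderTamAtThree` (item 19154) — THE HEIGHT IS THE LOGARITHM OF THE NUMERATOR, DEEP POINTS,
# part 7g: the 3-ADIC NUMERATOR HEIGHT `N(P) = lim_m 9^{−m}·log₃ num x(3^m P)` EXISTS (height-free statement),
# is quadratic along multiples, and THE canonical height is `N(P) − κ_E·log_E(P)²`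

HONEST FRAMING (cell `bsd-stepL`, seat `bsd-stepL-tam3-p2` g3, WIDTH-LEVER second lane «closed-form Schneider
local factor at 3 … finite case table proved once»; `--supports stmt-BirchSwinnertonDyer-19154 --as helper`):
THEOREMS ONLY, unconditional, route-independent (no Theses import); 0 definitions, 0 named facts, 0 sorry;
nothing here proves the crux `SchneiderTamAtThree`, Schneider's conjecture or BSD.

* §31 `exists_tendsto_numeratorTower` — **HEIGHT-FREE**: for `W/ℚ` globally minimal with non-split multiplicative
  reduction at `3` and ANY admissible rational point `P`, the sequence `9^{−m}·log₃ num x(3^m P)` CONVERGES in `ℚ₃`.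
  (Proof through THE Tate parameter and THE canonical datum — tree theorems `existsUnique_tateJ_eq_holds`,
  `SteinWuthrich2013.exists_isMultCanonical_holds` — and part 7d; none of them appears in the statement.) Its limit
  `N(P)` is the «`3`-adic numerator height» of `P`: a `q`-free, `σ`-free invariant of `(E, P)`.
* §32 `tendsto_numeratorTower_nsmul` — **HEIGHT-FREE**: `N(n·P) = n²·N(P)` (the tower of `nP` converges to `n²`
  times the limit of the tower of `P`).
* §33 `pairing_self_eq_lim_sub` — for THE canonical datum: if the tower of `P` tends to `N` then
  **`⟨P,P⟩ = N − κ_E·log_E(P)²`**, `κ_E = (C⁻²E₂(q) − b₂)/12`: Schneider's local factor at `3` is the difference of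
  the arithmetic quadratic invariant `N` and the quasi-period quadratic invariant `κ_E·log_E²`; in rank one both
  are multiples of `log_E(P)²`, so the crux per curve reads `ν_E ≠ κ_E` with `ν_E := N(P)/log_E(P)²` (prose; the
  kernel statements are §33 and part 7e).

References: [SteinWuthrich2013] §4.1–4.2; [MazurSteinTate2006] §1; [MazurTateTeitelbaum1986Invent] §II.4;
[SilvermanATAEC1994] Lemma V.5.1; tree: parts 7d, 7f.
-/

noncomputable section

open scoped Classical Nat
open Filter Topology IsUltrametricDist
open WeierstrassCurve Literature.NumberTheory.EllipticCurves
open Literature.NumberTheory.EllipticCurves.SteinWuthrich2013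
open Literature.NumberTheory.EllipticCurves.TateCurve
open Literature.NumberTheory.EllipticCurves.Rank1Residual
open Summit.BirchSwinnertonDyer.Uniform.UI.O2

namespace Summit.BirchSwinnertonDyer.Rank1Residual.X11b.RegMult.HeightLogNumerator

section NumeratorHeight

variable {W : WeierstrassCurve ℚ}

/-- **The `3`-adic numerator tower of an admissible point converges** (height-free statement). For `W/ℚ`
globally minimal with non-split multiplicative reduction at `3` and an admissible rational point `P = (x, y)`:
`∃ N ∈ ℚ₃, 9^{−m}·log₃ num x(3^m P) → N`. (`N = ⟨P,P⟩ + κ_E·log_E(P)²` for THE canonical datum, part 7d; the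
datum and the Tate parameter exist by tree theorems.) [cite: SteinWuthrich2013, §4.1 eq. (4.1), §4.2]
[cite: SilvermanATAEC1994, Lemma V.5.1] [cite: MazurSteinTate2006, §1] -/
theorem exists_tendsto_numeratorTower [W.IsElliptic] [W.IsGloballyMinimal] (hW : Mult W 3)
    (hns : ¬ W.HasSplitMultiplicativeReductionAtPrime 3) {x y : ℚ} {h : W.toAffine.Nonsingular x y}
    (hadm : W.IsAdmissible 3 (.some x y h)) :
    ∃ N : ℚ_[3], Tendsto (fun m : ℕ ↦ ((9 : ℚ_[3]) ^ m)⁻¹ *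
        padicLog 3 (((W.xCoord (3 ^ m • (.some x y h : W.toAffine.Point))).num : ℚ) : ℚ_[3])) atTop (𝓝 N) := by
  have hj : 1 < ‖(W.j : ℚ_[3])‖ := one_lt_norm_j_of_hasMultiplicativeReductionAtPrime (W := W) (p := 3) hW
  obtain ⟨q, ⟨hq0, hq, hjq⟩, -⟩ := existsUnique_tateJ_eq_holds 3 hj
  obtain ⟨Dh, hDh⟩ := exists_isMultCanonical_holds W 3 (by norm_num) hW hns q hq0 hq hjq
  exact ⟨_, tendsto_numeratorTower hW hq hDh hadm⟩

/-- **The numerator height is quadratic along multiples** (height-free statement): if the tower of the admissible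
point `P = (x, y)` tends to `N` and `n • P = (x', y')` (`n ≥ 1`), then the tower of `n • P` tends to `n²·N`.
(`N(P) = ⟨P,P⟩ + κ_E log_E(P)²` for THE datum, and both summands are quadratic: `⟨nP,nP⟩ = n²⟨P,P⟩`,
`log_E(nP) = n·log_E(P)`.) [cite: SteinWuthrich2013, §4.2] [cite: MazurTateTeitelbaum1986Invent, §II.4] -/
theorem tendsto_numeratorTower_nsmul [W.IsElliptic] [W.IsGloballyMinimal] (hW : Mult W 3)
    (hns : ¬ W.HasSplitMultiplicativeReductionAtPrime 3) {x y : ℚ} {h : W.toAffine.Nonsingular x y}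
    (hadm : W.IsAdmissible 3 (.some x y h)) {N : ℚ_[3]}
    (hN : Tendsto (fun m : ℕ ↦ ((9 : ℚ_[3]) ^ m)⁻¹ *
        padicLog 3 (((W.xCoord (3 ^ m • (.some x y h : W.toAffine.Point))).num : ℚ) : ℚ_[3])) atTop (𝓝 N))
    {n : ℕ} (hn : 1 ≤ n) {x' y' : ℚ} {h' : W.toAffine.Nonsingular x' y'}
    (hnP : n • (.some x y h : W.toAffine.Point) = .some x' y' h') :
    Tendsto (fun m : ℕ ↦ ((9 : ℚ_[3]) ^ m)⁻¹ *
        padicLog 3 (((W.xCoord (3 ^ m • (.some x' y' h' : W.toAffine.Point))).num : ℚ) : ℚ_[3]))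
      atTop (𝓝 ((n : ℚ_[3]) ^ 2 * N)) := by
  have hj : 1 < ‖(W.j : ℚ_[3])‖ := one_lt_norm_j_of_hasMultiplicativeReductionAtPrime (W := W) (p := 3) hW
  obtain ⟨q, ⟨hq0, hq, hjq⟩, -⟩ := existsUnique_tateJ_eq_holds 3 hj
  obtain ⟨Dh, hDh⟩ := exists_isMultCanonical_holds W 3 (by norm_num) hW hns q hq0 hq hjq
  have hadm' : W.IsAdmissible 3 (.some x' y' h') := by
    have hh := isAdmissible_nsmul hadm (by omega : n ≠ 0); rwa [hnP] at hh
  -- the towers of `P` and `nP` converge to `⟨·,·⟩ + κ_E log_E²`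
  have hT := tendsto_numeratorTower hW hq hDh hadm
  have hT' := tendsto_numeratorTower hW hq hDh hadm'
  have hNeq := tendsto_nhds_unique hN hT
  -- `⟨nP,nP⟩ = n²⟨P,P⟩`, `log_E(nP) = n log_E(P)`
  have hsq : Dh.pairing (.some x' y' h') (.some x' y' h') =
      (n : ℚ_[3]) ^ 2 * Dh.pairing (.some x y h) (.some x y h) := by
    rw [← hnP, map_nsmul, map_nsmul, AddMonoidHom.nsmul_apply, smul_smul, nsmul_eq_mul]
    push_cast; ring
  have hℓ : (W.baseChange ℚ_[3]).padicFormalLog (-(x' : ℚ_[3]) / y') =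
      (n : ℚ_[3]) * (W.baseChange ℚ_[3]).padicFormalLog (-(x : ℚ_[3]) / y) :=
    padicFormalLog_param_nsmul (p := 3) hadm n hn hnP
  rw [hsq, hℓ] at hT'
  convert hT' using 2
  rw [hNeq]; ring

/-- **THE canonical `3`-adic height = numerator height − quasi-period term.** For `W/ℚ` globally minimal with
multiplicative reduction at `3`, `‖q‖₃ < 1`, THE canonical datum `Dh` (`IsMultCanonical Dh q`) and an admissible
point `P = (x, y)` whose numerator tower tends to `N`: **`⟨P,P⟩ = N − κ_E·log_E(P)²`**,
`κ_E = (C⁻²E₂(q) − b₂)/12`. In rank one `N(P) = ν_E·log_E(P)²` for one constant `ν_E` of the curve, and the crux's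
deciding statement at the curve is `ν_E ≠ κ_E`. [cite: SteinWuthrich2013, §4.1 eq. (4.1), §4.2]
[cite: Schneider1982PadicHeightI, §1] -/
theorem pairing_self_eq_lim_sub [W.IsElliptic] [W.IsGloballyMinimal] (hW : Mult W 3) {q : ℚ_[3]}
    (hq : ‖q‖ < 1) {Dh : PAdicHeightData W 3} (hDh : IsMultCanonical Dh q) {x y : ℚ}
    {h : W.toAffine.Nonsingular x y} (hadm : W.IsAdmissible 3 (.some x y h)) {N : ℚ_[3]}
    (hN : Tendsto (fun m : ℕ ↦ ((9 : ℚ_[3]) ^ m)⁻¹ *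
        padicLog 3 (((W.xCoord (3 ^ m • (.some x y h : W.toAffine.Point))).num : ℚ) : ℚ_[3])) atTop (𝓝 N)) :
    Dh.pairing (.some x y h) (.some x y h) =
      N - ((uniformisationScaleSq W 3 q)⁻¹ * (1 - 24 * tateS 1 q) - (W.baseChange ℚ_[3]).b₂) / 12 *
        (W.baseChange ℚ_[3]).padicFormalLog (-(x : ℚ_[3]) / y) ^ 2 := by
  have hT := tendsto_numeratorTower hW hq hDh hadm
  have hNeq := tendsto_nhds_unique hN hT
  rw [hNeq]; ring

end NumeratorHeight

end Summit.BirchSwinnertonDyer.Rank1Residual.X11b.RegMult.HeightLogNumerator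

end
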